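import Summits.BirchSwinnertonDyer.BirchSwinnertonDyer.Theses.DerivedKatoValuationDoor
import Literature.NumberTheory.EllipticCurves.IwasawaAlgebraDivisibilityProofs
import Literature.NumberTheory.EllipticCurves.IwasawaAlgebraCharIdealProofs
import Literature.NumberTheory.EllipticCurves.NonEisensteinPrimeOfSurjective
import Literature.NumberTheory.EllipticCurves.Kato2004.MainConjecturePrimeTDoor

/-!
# BirchSwinnertonDyer / DerivedKatoValuationDoor — crux `DerivedKatoDoor` (stmt-BirchSwinnertonDyer-23024):
# `T`-saturation of `𝐇¹` and kill criterion (K-ii) modulo Kato's named Thm. 12.4 (standing disprover, cycle 1)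

The `T`-SATURATION hypothesis of the BSD-consistent kill criterion (file `LoadBearing`,
`derivedKatoDoor_false_of_fineLength_two`) is discharged here from the tree's NAMED fact
`Kato2004.thm12_4` (Kato Thm. 12.4 (3): at `p ≠ 2` with `E[p]` irreducible, `𝐇¹` is free of rank one):

* `derivedKatoDoor_exists_eq_X_pow_smul_of_le_lengthAt` — ALGEBRA (proved): for a free `Λ`-module `H`
  of rank one and any `z₀ ∈ H`, `k ≤ ℓ_T(H/Λz₀) ⇒ z₀ ∈ T^k H` (transport to `Λ`, then "`ord_T` is the
  valuation", tree lemma `Module.pow_dvd_of_le_lengthAt_quotient` with `PowerSeries.X_prime`).  This is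
  the converse of line `lower`'s algebra stub L1 in the free case.
* `derivedKatoDoor_exists_eq_X_pow_smul_of_thm12_4` — at a door prime (`5 ≤ p`, `ρ̄` onto ⇒ `E[p]`
  irreducible, `hasIrreducibleModPGaloisRep_of_hasSurjectiveModNGaloisRep`), `thm12_4` makes every
  `IwasawaH1Data.H` free of rank one, so `k ≤ ℓ_T(𝐇¹/Λz₀) ⇒ ∃ h, z₀ = T^k h` (in particular
  `p^0 z₀ ∈ T² 𝐇¹` from `2 ≤ ℓ_T`).
* `derivedKatoDoor_quotientLength_le_one_of_not_TSq_smul` — the LEAD's displayed hypothesis `hCyc` of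
  `Lines/lower.lean` `fineLengthLeOne_of_crux` («`T² ∤ p^m z₀ ⇒ ℓ_T(𝐇¹/Λz₀) ≤ 1`») DISCHARGED modulo
  `thm12_4` (admissibility not even needed).
* `derivedKatoDoor_fineLength_le_quotientLength_of_mainConjecturePrimeT` — Kato's divisibility at `(T)`
  in the form used by (K-ii) (`ℓ_T(X₀) ≤ ℓ_T(𝐇¹/Λz₀)`), read off the named fact
  `Kato2004.kato_mainConjecture_primeT_of_door` (typed by seat w2; it gives `=`).
* `derivedKatoDoor_false_of_fineLength_two_of_thm12_4` — KILL CRITERION (K-ii) with saturation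
  discharged: modulo `thm12_4` and Kato's divisibility at `(T)` (print, proved: `ℓ_T(X₀) ≤ ℓ_T(𝐇¹/Λz₀)`
  for admissible `z₀` at door primes), ONE analytic-rank-two door cell with `2 ≤ ℓ_T(X₀(E/ℚ_∞))` (a
  `T²`-Jordan block in the fine Selmer dual — failure of Greenberg's semisimplicity conjecture) and an
  admissible class refutes the crux.  No such cell is known; settles nothing.
* `derivedKatoDoor_false_of_fineLength_two_of_facts` — the same modulo the two NAMED tree facts
  `thm12_4` + `kato_mainConjecture_primeT_of_door` and ONE cell (`a = 2`, door prime, `2 ≤ ℓ_T(X₀)`,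
  an admissible class): the crux's BSD-consistent failure mode, fully typed against the tree.

No statement of the route is asserted positively.  BSD is not proved by any of this.
-/

set_option linter.dupNamespace false

noncomputable section

namespace Summit.BirchSwinnertonDyer.BirchSwinnertonDyer.Theorems

open Literature Literature.NumberTheory.GaloisRepresentations
open Literature.NumberTheory.EllipticCurves Literature.NumberTheory.EllipticCurves.Kato2004
open Literature.NumberTheory.EllipticCurves.Kato2004.EulerSystemValues
open Summit.BirchSwinnertonDyer.BirchSwinnertonDyer.Theses.DerivedKatoValuationDoor

/-- **`ord_T` detects `T`-divisibility in a free rank-one `Λ`-module**: if `H ≅ Λ` and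
`k ≤ ℓ_T(H/Λz₀)` then `z₀ ∈ T^k H`.  Transport along a basis `H ≃ₗ Λ`, `z₀ ↦ f`; `H/Λz₀ ≅ Λ/(f)`;
`k ≤ length_{(T)} Λ/(f) ⇒ T^k ∣ f` (`Module.pow_dvd_of_le_lengthAt_quotient`, `T` prime in the
Noetherian domain `Λ = ℤ_p⟦T⟧`); `z₀ = 0` is the trivial case (`ℓ_T = ⊤`, `0 = T^k • 0`).
[cite: Washington1997, §13.2] -/
theorem derivedKatoDoor_exists_eq_X_pow_smul_of_le_lengthAt {p : ℕ} [Fact p.Prime] {H : Type*}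
    [AddCommGroup H] [Module (IwasawaAlgebra p) H] [Module.Free (IwasawaAlgebra p) H]
    (hrank : Module.finrank (IwasawaAlgebra p) H = 1) (z₀ : H) {k : ℕ}
    (hk : (k : ℕ∞) ≤ Module.lengthAt (IwasawaAlgebra p) (H ⧸ Submodule.span (IwasawaAlgebra p) {z₀})
      (IwasawaAlgebra.primeT p)) :
    ∃ h : H, z₀ = ((PowerSeries.X : IwasawaAlgebra p) ^ k) • h := by
  classical
  by_cases hz : z₀ = 0
  · exact ⟨0, by rw [hz, smul_zero]⟩
  let e : H ≃ₗ[IwasawaAlgebra p] IwasawaAlgebra p :=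
    (Module.basisUnique (Fin 1) hrank).repr.trans
      (Finsupp.uniqueLinearEquiv (IwasawaAlgebra p) (IwasawaAlgebra p) (0 : Fin 1))
  have hf0 : e z₀ ≠ 0 := fun h0 => hz (e.injective (by rw [h0, map_zero]))
  have hmap : (Submodule.span (IwasawaAlgebra p) {z₀}).map (e : H →ₗ[IwasawaAlgebra p] IwasawaAlgebra p) =
      Ideal.span {e z₀} := by
    rw [Submodule.map_span]
    show Submodule.span (IwasawaAlgebra p) ((fun x => e x) '' {z₀}) = Ideal.span {e z₀}
    rw [Set.image_singleton]
  have eq : (H ⧸ Submodule.span (IwasawaAlgebra p) {z₀}) ≃ₗ[IwasawaAlgebra p]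
      (IwasawaAlgebra p ⧸ Ideal.span {e z₀}) :=
    Submodule.Quotient.equiv _ _ e hmap
  rw [Module.lengthAt_eq_of_linearEquiv eq] at hk
  obtain ⟨g, hg⟩ := Module.pow_dvd_of_le_lengthAt_quotient PowerSeries.X_prime hf0
    (IwasawaAlgebra.primeT p) (IwasawaAlgebra.primeT_asIdeal p) hk
  refine ⟨e.symm g, e.injective ?_⟩
  rw [map_smul, LinearEquiv.apply_symm_apply, smul_eq_mul, ← hg]

/-- **`T`-saturation of `𝐇¹` at door primes, modulo the named fact `Kato2004.thm12_4`** (Thm. 12.4 (3):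
`p ≠ 2`, `E[p]` irreducible ⇒ `𝐇¹` free of rank one; at a door prime `5 ≤ p` and `ρ̄` onto ⇒
irreducible): for every cyclotomic datum, topological generator, `I : IwasawaH1Data` and `z₀ ∈ 𝐇¹`,
`k ≤ ℓ_T(𝐇¹/Λz₀) ⇒ ∃ h, z₀ = T^k h`. [cite: Kato2004Asterisque, Thm. 12.4 (3) (p. 221)] -/
theorem derivedKatoDoor_exists_eq_X_pow_smul_of_thm12_4 (h124 : Kato2004.thm12_4)
    (W : WeierstrassCurve ℚ) [W.IsElliptic] [W.IsGloballyMinimal] (p : ℕ) [Fact p.Prime]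
    [ContinuousSMul ℤ_[p] (W.tateModule p)]
    (hdoor : 5 ≤ p ∧ IsOrdinaryAt W p ∧ W.HasSurjectiveModNGaloisRep p)
    (K : ZpExtension ℚ p) (hK : K.IsCyclotomic) (γ : Field.absoluteGaloisGroup ℚ)
    (I : IwasawaH1Data W p K γ) (z₀ : I.H) (hγ : K.IsTopGenerator γ) {k : ℕ}
    (hk : (k : ℕ∞) ≤ Module.lengthAt (IwasawaAlgebra p) (I.H ⧸ Submodule.span (IwasawaAlgebra p) {z₀})
      (IwasawaAlgebra.primeT p)) :
    ∃ h : I.H, z₀ = ((PowerSeries.X : IwasawaAlgebra p) ^ k) • h := by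
  have hp2 : p ≠ 2 := by have := hdoor.1; omega
  haveI : NeZero (p : ℚ) := ⟨Nat.cast_ne_zero.mpr (Fact.out : p.Prime).ne_zero⟩
  have hirr : W.HasIrreducibleModPGaloisRep p :=
    hasIrreducibleModPGaloisRep_of_hasSurjectiveModNGaloisRep W p hdoor.2.2
  obtain ⟨hfree, hrank⟩ := (h124 W p K γ hK hγ I).2.2 hp2 hirr
  exact derivedKatoDoor_exists_eq_X_pow_smul_of_le_lengthAt hrank z₀ hk

/-- **KILL CRITERION (K-ii) with `T`-saturation discharged** — modulo the named fact
`Kato2004.thm12_4` and Kato's divisibility at the height-one prime `(T)` (PROVED in print: Kato Thm.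
12.5 (4)/17.4 under big image, `Z_(T) = Λ_(T) z₀`, `X₀ ↪ 𝐇²` with finite cokernel), ONE
analytic-rank-two curve with a door prime, a cyclotomic datum with `2 ≤ ℓ_T(X₀(E/ℚ_∞))` and an
admissible class refutes the crux.  Under BSD (`rank X₀/TX₀ = 1`) the hypothesis `2 ≤ ℓ_T(X₀)` is a
`T²`-Jordan block in the dual fine Selmer group: a failure of Greenberg's semisimplicity conjecture
(Kurihara–Pollack Problem 0.7; Lim 2022 Conj. 4.2).  No example is known; settles nothing.
[cite: Kato2004Asterisque, Thm. 12.4 (3) (p. 221), Thm. 12.5 (4) (p. 222), Conj. 12.10 (p. 224)]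
[cite: KuriharaPollack2007, Problem 0.7] [cite: Lim2022OrderVanishing, Conj. 4.2] -/
theorem derivedKatoDoor_false_of_fineLength_two_of_thm12_4 (h124 : Kato2004.thm12_4)
    (hdiv : ∀ (W : WeierstrassCurve ℚ) [W.IsElliptic] [W.IsGloballyMinimal] (p : ℕ) [Fact p.Prime]
      [ContinuousSMul ℤ_[p] (W.tateModule p)],
      (5 ≤ p ∧ IsOrdinaryAt W p ∧ W.HasSurjectiveModNGaloisRep p) →
      ∀ (K : ZpExtension ℚ p) (hK : K.IsCyclotomic) (γ : Field.absoluteGaloisGroup ℚ)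
        (I : IwasawaH1Data W p K γ) (z₀ : I.H) (hγ : K.IsTopGenerator γ),
        IsAdmissibleZetaClass W p K hK I z₀ →
          Module.lengthAt (IwasawaAlgebra p) (W.fineSelmerDualData K hγ).X (IwasawaAlgebra.primeT p) ≤
            Module.lengthAt (IwasawaAlgebra p) (I.H ⧸ Submodule.span (IwasawaAlgebra p) {z₀})
              (IwasawaAlgebra.primeT p))
    (W : WeierstrassCurve ℚ) [W.IsElliptic] [W.IsGloballyMinimal] (p : ℕ) [Fact p.Prime]
    [ContinuousSMul ℤ_[p] (W.tateModule p)] (ha : W.analyticRank = 2)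
    (hdoor : 5 ≤ p ∧ IsOrdinaryAt W p ∧ W.HasSurjectiveModNGaloisRep p)
    (K : ZpExtension ℚ p) (hK : K.IsCyclotomic) (γ : Field.absoluteGaloisGroup ℚ)
    (hγ : K.IsTopGenerator γ)
    (hX : (2 : ℕ∞) ≤
      Module.lengthAt (IwasawaAlgebra p) (W.fineSelmerDualData K hγ).X (IwasawaAlgebra.primeT p))
    (hadm : ∃ (I : IwasawaH1Data W p K γ) (z₀ : I.H), IsAdmissibleZetaClass W p K hK I z₀) :
    ¬ DerivedKatoDoor := by
  intro hD
  obtain ⟨I, z₀, hz⟩ := hadm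
  have h2 : ((2 : ℕ) : ℕ∞) ≤ Module.lengthAt (IwasawaAlgebra p)
      (I.H ⧸ Submodule.span (IwasawaAlgebra p) {z₀}) (IwasawaAlgebra.primeT p) :=
    hX.trans (hdiv W p hdoor K hK γ I z₀ hγ hz)
  obtain ⟨h, hh⟩ := derivedKatoDoor_exists_eq_X_pow_smul_of_thm12_4 h124 W p hdoor K hK γ I z₀ hγ h2
  exact hD W p ha hdoor K hK γ I z₀ hγ hz ⟨h, 0, by rw [pow_zero, one_smul, hh]⟩

/-- **The LEAD's hypothesis `hCyc` discharged modulo `Kato2004.thm12_4`:** at a door prime, for every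
cyclotomic datum and every `z₀ ∈ 𝐇¹` (admissible or not), `T² ∤ p^m z₀` for all `m` ⇒ `ℓ_T(𝐇¹/Λz₀) ≤ 1`
(contrapositive of saturation at `k = 2`, `m = 0`).  Plug into `Lines/lower.lean`'s
`fineLengthLeOne_of_crux` as `hCyc := fun W _ _ p _ _ hd K hK γ I z₀ hγ _ hv => … hv`.
[cite: Kato2004Asterisque, Thm. 12.4 (3) (p. 221)] -/
theorem derivedKatoDoor_quotientLength_le_one_of_not_TSq_smul (h124 : Kato2004.thm12_4)
    (W : WeierstrassCurve ℚ) [W.IsElliptic] [W.IsGloballyMinimal] (p : ℕ) [Fact p.Prime]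
    [ContinuousSMul ℤ_[p] (W.tateModule p)]
    (hdoor : 5 ≤ p ∧ IsOrdinaryAt W p ∧ W.HasSurjectiveModNGaloisRep p)
    (K : ZpExtension ℚ p) (hK : K.IsCyclotomic) (γ : Field.absoluteGaloisGroup ℚ)
    (I : IwasawaH1Data W p K γ) (z₀ : I.H) (hγ : K.IsTopGenerator γ)
    (hv : ¬ ∃ (h : I.H) (m : ℕ),
      ((p : IwasawaAlgebra p) ^ m) • z₀ = ((PowerSeries.X : IwasawaAlgebra p) ^ 2) • h) :
    Module.lengthAt (IwasawaAlgebra p) (I.H ⧸ Submodule.span (IwasawaAlgebra p) {z₀})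
      (IwasawaAlgebra.primeT p) ≤ 1 := by
  by_contra hle
  have h2 : ((2 : ℕ) : ℕ∞) ≤ Module.lengthAt (IwasawaAlgebra p)
      (I.H ⧸ Submodule.span (IwasawaAlgebra p) {z₀}) (IwasawaAlgebra.primeT p) := by
    have h := Order.add_one_le_of_lt (not_le.mp hle)
    rwa [one_add_one_eq_two] at h
  obtain ⟨h, hh⟩ := derivedKatoDoor_exists_eq_X_pow_smul_of_thm12_4 h124 W p hdoor K hK γ I z₀ hγ h2
  exact hv ⟨h, 0, by rw [pow_zero, one_smul, hh]⟩

/-- **Kato's divisibility at `(T)` in the (K-ii) shape, from the named fact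
`Kato2004.kato_mainConjecture_primeT_of_door`** (Kato Conj. 12.10 at `(T)` at door primes — BCS 2025 +
Kato §17.13 + (14.9.1), typed by seat w2; it yields `ℓ_T(J.H2) = ℓ_T(𝐇¹/Λz₀)` and `X₀ ↪ J.H2` with finite
cokernel, whence `ℓ_T(X₀) = ℓ_T(𝐇¹/Λz₀)`; only `≤` is used by (K-ii)).
[cite: Kato2004Asterisque, Conj. 12.10 (p. 224), §17.13 (pp. 279–280)] [cite: BurungaleCastellaSkinner2025, Thm. 1.1.2 (a)] -/
theorem derivedKatoDoor_fineLength_le_quotientLength_of_mainConjecturePrimeT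
    (hmc : Kato2004.kato_mainConjecture_primeT_of_door)
    (W : WeierstrassCurve ℚ) [W.IsElliptic] [W.IsGloballyMinimal] (p : ℕ) [Fact p.Prime]
    [ContinuousSMul ℤ_[p] (W.tateModule p)]
    (hdoor : 5 ≤ p ∧ IsOrdinaryAt W p ∧ W.HasSurjectiveModNGaloisRep p)
    (K : ZpExtension ℚ p) (hK : K.IsCyclotomic) (γ : Field.absoluteGaloisGroup ℚ)
    (I : IwasawaH1Data W p K γ) (z₀ : I.H) (hγ : K.IsTopGenerator γ)
    (hz : IsAdmissibleZetaClass W p K hK I z₀) :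
    Module.lengthAt (IwasawaAlgebra p) (W.fineSelmerDualData K hγ).X (IwasawaAlgebra.primeT p) ≤
      Module.lengthAt (IwasawaAlgebra p) (I.H ⧸ Submodule.span (IwasawaAlgebra p) {z₀})
        (IwasawaAlgebra.primeT p) := by
  obtain ⟨J, e, he, hfin, hlen⟩ := hmc W p hdoor.1 hdoor.2.1 hdoor.2.2 K hK γ hγ I
  exact ((Kato2004.lengthAt_eq_of_injective_of_finite_quotient e he hfin _
    (IwasawaAlgebra.height_primeT p).le).trans (hlen z₀ hz)).le

/-- **KILL CRITERION (K-ii) modulo the two NAMED tree facts** `Kato2004.thm12_4` and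
`Kato2004.kato_mainConjecture_primeT_of_door`: ONE analytic-rank-two curve with a door prime `p`, a
cyclotomic datum `(K, γ)` with `2 ≤ ℓ_T(X₀(E/ℚ_∞))` and an admissible class refutes `DerivedKatoDoor`.
Under BSD this cell is a `T²`-Jordan block in the dual fine Selmer group (Greenberg semisimplicity failure,
Kurihara–Pollack Problem 0.7, Lim 2022 Conj. 4.2); no example is known — the crux's genuine open content,
typed against the tree.  Settles nothing; BSD is not proved by any of this.
[cite: KuriharaPollack2007, Problem 0.7] [cite: Lim2022OrderVanishing, Conj. 4.2]
[cite: Kato2004Asterisque, Thm. 12.4 (3) (p. 221), Conj. 12.10 (p. 224)] -/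
theorem derivedKatoDoor_false_of_fineLength_two_of_facts (h124 : Kato2004.thm12_4)
    (hmc : Kato2004.kato_mainConjecture_primeT_of_door)
    (W : WeierstrassCurve ℚ) [W.IsElliptic] [W.IsGloballyMinimal] (p : ℕ) [Fact p.Prime]
    [ContinuousSMul ℤ_[p] (W.tateModule p)] (ha : W.analyticRank = 2)
    (hdoor : 5 ≤ p ∧ IsOrdinaryAt W p ∧ W.HasSurjectiveModNGaloisRep p)
    (K : ZpExtension ℚ p) (hK : K.IsCyclotomic) (γ : Field.absoluteGaloisGroup ℚ)
    (hγ : K.IsTopGenerator γ)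
    (hX : (2 : ℕ∞) ≤
      Module.lengthAt (IwasawaAlgebra p) (W.fineSelmerDualData K hγ).X (IwasawaAlgebra.primeT p))
    (hadm : ∃ (I : IwasawaH1Data W p K γ) (z₀ : I.H), IsAdmissibleZetaClass W p K hK I z₀) :
    ¬ DerivedKatoDoor :=
  derivedKatoDoor_false_of_fineLength_two_of_thm12_4 h124
    (fun W _ _ p _ _ hd K hK γ I z₀ hγ hz =>
      derivedKatoDoor_fineLength_le_quotientLength_of_mainConjecturePrimeT hmc W p hd K hK γ I z₀ hγ hz)
    W p ha hdoor K hK γ hγ hX hadm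

end Summit.BirchSwinnertonDyer.BirchSwinnertonDyer.Theorems

end
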